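import Mathlib
import Literature.AlgebraicGeometry.Resolution.CurveDeltaDrop
import HarnessLib

/-!
# Overrings of Dedekind domains are integrally closed; finite normalization of intermediate rings

Topic: `Literature/AlgebraicGeometry/Resolution`. Two classical facts of commutative algebra used by
the blow-up tower of a one-dimensional local ring (Kollár 2007, §1.4 / Thm. 1.101; Krull 1930):

* `mem_range_of_isIntegral_of_inv_mem_range` — a local subring `L` of a field is "closed under
  integral inverses": if `x` is integral over `L` and `x⁻¹ ∈ L` then `x ∈ L` (the computation behind
  "valuation rings are integrally closed");
* `mem_of_isIntegral_of_isDedekindDomain` — **every overring `N ⊆ T ⊆ K` of a Dedekind domain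
  `N` (inside its fraction field `K`) is integrally closed in `K`**: at a maximal ideal `𝔑` of `T`
  the local ring `T_𝔑` contains the valuation ring `N_{𝔑 ∩ N}`, hence `x` or `x⁻¹` lies in
  `T_𝔑`, and the previous lemma applies;
* `integralClosure_eq_adjoin_of_isDedekindDomain`, `module_finite_integralClosure_of_le` — hence
  for a domain `D` whose normalization `D̄ ⊆ K` is a Dedekind domain and a finite `D`-module (e.g.
  a one-dimensional Noetherian domain with finite normalization), EVERY intermediate ring
  `D ⊆ S ⊆ K` has normalization `S̄ = S[D̄]`, a finite `S`-module.

All statements are PROVED. Used for the persistence of "finite normalization" along quadratic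
transforms (`LocalQuadraticTransform.lean`).

## Sources

* J. Kollár, *Lectures on Resolution of Singularities*, Ann. of Math. Stud. 166 (2007), §1.4,
  Thm. 1.101. [Kollar2007]
* H. Matsumura, *Commutative Ring Theory* (1986), §10–§11 (valuation rings, Krull–Akizuki).
  [Matsumura1987]
-/

noncomputable section

open IsLocalRing Polynomial

namespace Literature.AlgebraicGeometry.Resolution

universe u v

/-! ## Integral elements whose inverse lies in a local subring -/

section LocalInverse

variable {L : Type u} [CommRing L] [IsLocalRing L] {K : Type v} [Field K]

/-- **A local subring of a field is closed under integral inverses.** Let `φ : L → K` be an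
injective ring homomorphism from a local ring to a field, `x ∈ K` a root of a monic polynomial
with coefficients in `L`, and `x⁻¹ ∈ φ(L)`. Then `x ∈ φ(L)`: writing `x⁻¹ = φ(y)`, if `y` were a
non-unit then the reversed equation `1 + c₁ y + ⋯ + c_n yⁿ = 0` would put `1` in the maximal
ideal — the computation proving that valuation rings are integrally closed.
[cite: Matsumura1987, Thm. 10.3 (proof), p. 72] -/
theorem mem_range_of_isIntegral_of_inv_mem_range (φ : L →+* K) (hφ : Function.Injective φ)
    {x : K} {p : L[X]} (hp : p.Monic) (hpx : p.eval₂ φ x = 0) (hinv : x⁻¹ ∈ φ.range) :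
    x ∈ φ.range := by
  obtain ⟨y, hy⟩ := hinv
  by_cases hx0 : x = 0
  · exact ⟨0, by rw [map_zero, hx0]⟩
  -- it suffices that `y` is a unit of `L`
  suffices hyu : IsUnit y by
    obtain ⟨u, rfl⟩ := hyu
    refine ⟨((u⁻¹ : Lˣ) : L), ?_⟩
    have h1 : φ ((u⁻¹ : Lˣ) : L) * φ (u : L) = 1 := by
      rw [← map_mul, Units.inv_mul, map_one]
    rw [hy] at h1
    -- `φ (u⁻¹) * x⁻¹ = 1`
    calc φ ((u⁻¹ : Lˣ) : L) = φ ((u⁻¹ : Lˣ) : L) * x⁻¹ * x := by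
            rw [mul_assoc, inv_mul_cancel₀ hx0, mul_one]
      _ = x := by rw [h1, one_mul]
  by_contra hyu
  have hym : y ∈ maximalIdeal L := (mem_maximalIdeal _).mpr hyu
  -- the reversed polynomial vanishes at `y`
  haveI : Invertible x := invertibleOfNonzero hx0
  have hrev : (p.reverse).eval₂ φ (⅟ x) = 0 := (eval₂_reverse_eq_zero_iff φ x p).mpr hpx
  rw [invOf_eq_inv, ← hy, eval₂_at_apply] at hrev
  have hrev' : eval y p.reverse = 0 := hφ (by rw [map_zero]; exact hrev)
  -- `p.reverse = C 1 + X * q`, so `1 ∈ 𝔪`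
  have hsplit := X_mul_divX_add p.reverse
  rw [coeff_zero_reverse, hp.leadingCoeff] at hsplit
  have h1 : (1 : L) = -(y * eval y p.reverse.divX) := by
    have := congrArg (eval y) hsplit
    rw [eval_add, eval_mul, eval_X, eval_C, hrev'] at this
    linear_combination this
  have hmem : (1 : L) ∈ maximalIdeal L := by
    rw [h1]
    exact (maximalIdeal L).neg_mem (Ideal.mul_mem_right _ _ hym)
  exact (maximalIdeal.isMaximal L).ne_top (Ideal.eq_top_of_isUnit_mem _ hmem isUnit_one)

end LocalInverse

/-! ## Overrings of a Dedekind domain -/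

section Overring

variable {N : Type u} [CommRing N] [IsDedekindDomain N] {K : Type u} [Field K] [Algebra N K]
  [IsFractionRing N K]

open IsDedekindDomain

/-- **Overrings of a Dedekind domain are integrally closed.** Let `N` be a Dedekind domain with
fraction field `K` and `T` a subring with `N ⊆ T ⊆ K`. Then every `x ∈ K` integral over `T` lies
in `T`. Proof: if not, the conductor-type ideal `J = {s ∈ T : s x ∈ T}` is proper, contained in a
maximal ideal `𝔑`; the local ring `T_𝔑 ⊆ K` contains the valuation ring `N_{𝔑 ∩ N}` of `K`
(a discrete valuation ring, or `K` itself when `𝔑 ∩ N = 0`), so `x ∈ T_𝔑` or `x⁻¹ ∈ T_𝔑`, and in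
the second case `x ∈ T_𝔑` as well (`mem_range_of_isIntegral_of_inv_mem_range`); but `x ∈ T_𝔑`
means `s x ∈ T` for some `s ∉ 𝔑`, contradicting `J ⊆ 𝔑`. [cite: Matsumura1987, Thm. 10.4 and §11]
-/
theorem mem_of_isIntegral_of_isDedekindDomain (T : Subalgebra N K) {x : K}
    (hx : IsIntegral T x) : x ∈ T := by
  classical
  by_contra hxT
  -- the denominator ideal of `x` in `T`
  let J : Ideal T :=
    { carrier := {s | (s : K) * x ∈ T}
      add_mem' := fun {a b} ha hb => by
        change ((a + b : T) : K) * x ∈ T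
        rw [Subalgebra.coe_add, add_mul]
        exact T.add_mem ha hb
      zero_mem' := by
        change ((0 : T) : K) * x ∈ T
        rw [Subalgebra.coe_zero, zero_mul]
        exact T.zero_mem
      smul_mem' := fun c {s} hs => by
        change ((c • s : T) : K) * x ∈ T
        rw [smul_eq_mul, Subalgebra.coe_mul, mul_assoc]
        exact T.mul_mem c.2 hs }
  have hJ : J ≠ ⊤ := by
    intro h
    have h1 : (1 : T) ∈ J := h ▸ Submodule.mem_top
    change ((1 : T) : K) * x ∈ T at h1
    rw [Subalgebra.coe_one, one_mul] at h1
    exact hxT h1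
  obtain ⟨𝔑, h𝔑max, hJ𝔑⟩ := Ideal.exists_le_maximal J hJ
  have key : ∀ (a s : T), s ∉ 𝔑 → x * (s : K) = a → False := fun a s hs h =>
    hs (hJ𝔑 (show (s : K) * x ∈ T by rw [mul_comm, h]; exact a.2))
  -- the local ring `T_𝔑` and its embedding `φ` into `K`
  let L : Type u := Localization.AtPrime 𝔑
  have hunit : ∀ s : 𝔑.primeCompl, IsUnit (algebraMap T K s) := fun s =>
    isUnit_iff_ne_zero.mpr (by
      intro h0
      apply s.2
      have : (s : T) = 0 := Subtype.ext h0
      rw [this]; exact 𝔑.zero_mem)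
  let φ : L →+* K := IsLocalization.lift (M := 𝔑.primeCompl) hunit
  have hφalg : ∀ t : T, φ (algebraMap T L t) = (t : K) := fun t => IsLocalization.lift_eq hunit t
  have hφinj : Function.Injective φ := by
    refine (IsLocalization.lift_injective_iff _).mpr fun a b => ⟨fun h => ?_, fun h => ?_⟩
    · rw [IsLocalization.injective L 𝔑.primeCompl_le_nonZeroDivisors h]
    · have : a = b := Subtype.ext h
      rw [this]
  -- `x ∈ φ(L)` is impossible
  have hxrange : x ∉ φ.range := by
    rintro ⟨z, hz⟩
    obtain ⟨a, s, rfl⟩ := IsLocalization.exists_mk'_eq 𝔑.primeCompl z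
    have h := (IsLocalization.lift_mk'_spec (hg := hunit) a x s).mp hz
    -- `(a : K) = (s : K) * x`
    exact key a s s.2 (by rw [mul_comm]; exact h.symm)
  -- dichotomy: `x ∈ T_𝔑` or `x⁻¹ ∈ T_𝔑`, from the valuation ring `N_{𝔑 ∩ N}`
  let 𝔭 : Ideal N := 𝔑.comap (algebraMap N T)
  haveI : 𝔭.IsPrime := Ideal.comap_isPrime _ _
  have hcoe : ∀ n : N, ((algebraMap N T n : T) : K) = algebraMap N K n := fun n => rfl
  have hinv : x⁻¹ ∈ φ.range := by
    by_cases h𝔭 : 𝔭 = ⊥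
    · -- `N ∖ 0` consists of units of `T_𝔑`: `x` itself lies in `T_𝔑`
      exfalso
      obtain ⟨n, d, hd, hnd⟩ := IsFractionRing.div_surjective (A := N) x
      have hd0 : algebraMap N K d ≠ 0 :=
        IsFractionRing.to_map_ne_zero_of_mem_nonZeroDivisors hd
      have hdN : algebraMap N T d ∉ 𝔑 := by
        intro hmem
        have : d ∈ 𝔭 := hmem
        rw [h𝔭, Ideal.mem_bot] at this
        exact hd0 (by rw [this, map_zero])
      refine key (algebraMap N T n) (algebraMap N T d) hdN ?_
      rw [hcoe, hcoe, ← hnd, div_mul_cancel₀ _ hd0]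
    · let v : HeightOneSpectrum N := ⟨𝔭, inferInstance, h𝔭⟩
      obtain ⟨n, d, hnd | hnd⟩ := v.exists_primeCompl_mul_eq_or_mul_eq (K := K) x
      · exfalso
        have hdN : algebraMap N T (d : N) ∉ 𝔑 := fun hmem => d.2 hmem
        exact key (algebraMap N T n) (algebraMap N T d) hdN (by rw [hcoe, hcoe]; exact hnd)
      · have hd0 : algebraMap N K (d : N) ≠ 0 := by
          intro h0
          exact d.2 (show (d : N) ∈ 𝔭 by
            rw [IsFractionRing.to_map_eq_zero_iff] at h0
            rw [h0]; exact 𝔭.zero_mem)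
        have hx0 : x ≠ 0 := by
          rintro rfl
          rw [zero_mul] at hnd
          exact hd0 hnd.symm
        have hdN : algebraMap N T (d : N) ∉ 𝔑 := fun hmem => d.2 hmem
        refine ⟨IsLocalization.mk' L (algebraMap N T n) (⟨algebraMap N T d, hdN⟩ : 𝔑.primeCompl), ?_⟩
        apply (IsLocalization.lift_mk'_spec (hg := hunit) _ _ _).mpr
        change ((algebraMap N T n : T) : K) = ((algebraMap N T (d : N) : T) : K) * x⁻¹
        rw [hcoe, hcoe, ← hnd, mul_assoc, mul_comm _ x⁻¹, ← mul_assoc, mul_inv_cancel₀ hx0,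
          one_mul]
  -- `x` is integral over `L` (via `T → L`), so `x ∈ φ(L)` by the local-inverse lemma
  obtain ⟨p, hp, hpx⟩ := hx
  have hcomp : φ.comp (algebraMap T L) = algebraMap T K := RingHom.ext fun t => hφalg t
  have hpx' : (p.map (algebraMap T L)).eval₂ φ x = 0 := by
    rw [eval₂_map, hcomp]; exact hpx
  exact hxrange (mem_range_of_isIntegral_of_inv_mem_range φ hφinj (hp.map _) hpx' hinv)

end Overring

/-! ## Finite normalization of intermediate rings -/

section Intermediate

variable {D : Type u} [CommRing D] [IsDomain D] {K : Type u} [Field K] [Algebra D K]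
  [IsFractionRing D K]

/-- **The normalization of an intermediate ring `D ⊆ S ⊆ K` is `S[D̄]`** when `D̄` is a Dedekind
domain (e.g. `D` one-dimensional Noetherian with finite normalization): `S[D̄]` is an overring of
`D̄`, hence integrally closed (`mem_of_isIntegral_of_isDedekindDomain`), and it is integral over `S`.
[cite: Kollar2007, §1.4] -/
theorem integralClosure_eq_adjoin_of_isDedekindDomain [IsDedekindDomain (integralClosure D K)]
    (S : Subalgebra D K) :
    integralClosure S K = Algebra.adjoin S ((integralClosure D K : Subalgebra D K) : Set K) := by
  haveI : IsFractionRing (integralClosure D K) K := isFractionRing_integralClosure D K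
  -- `S[D̄]` as a `D̄`-subalgebra of `K` (an overring of the Dedekind domain `D̄`)
  let T : Subalgebra (integralClosure D K) K :=
    { carrier := Algebra.adjoin S ((integralClosure D K : Subalgebra D K) : Set K)
      mul_mem' := fun ha hb => Subalgebra.mul_mem _ ha hb
      one_mem' := Subalgebra.one_mem _
      add_mem' := fun ha hb => Subalgebra.add_mem _ ha hb
      zero_mem' := Subalgebra.zero_mem _
      algebraMap_mem' := fun a => Algebra.subset_adjoin a.2 }
  have hT : ∀ {x : K}, x ∈ T ↔
      x ∈ Algebra.adjoin S ((integralClosure D K : Subalgebra D K) : Set K) := Iff.rfl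
  apply le_antisymm
  · intro x hx
    -- `x` is integral over `S ⊆ S[D̄]`
    have hx' : IsIntegral T x := by
      obtain ⟨p, hp, hpx⟩ := hx
      let f : S →+* T :=
        (algebraMap S K).codRestrict T.toSubring fun s =>
          Subalgebra.algebraMap_mem
            (Algebra.adjoin S ((integralClosure D K : Subalgebra D K) : Set K)) s
      have hf : (algebraMap T K).comp f = algebraMap S K := RingHom.ext fun _ => rfl
      refine ⟨p.map f, hp.map f, ?_⟩
      rw [eval₂_map, hf]
      exact hpx
    exact hT.mp (mem_of_isIntegral_of_isDedekindDomain T hx')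
  · refine Algebra.adjoin_le fun n hn => ?_
    have h : IsIntegral D n := hn
    exact h.tower_top

/-- **Finite normalization persists to intermediate rings**: if `D̄` is a Dedekind domain and a
finite `D`-module, then for every intermediate ring `D ⊆ S ⊆ K` the normalization `S̄ = S[D̄]` is
a finite `S`-module. [cite: Kollar2007, §1.4] -/
theorem module_finite_integralClosure_of_le [IsDedekindDomain (integralClosure D K)]
    [Module.Finite D (integralClosure D K)] (S : Subalgebra D K) :
    Module.Finite S (integralClosure S K) := by
  classical
  -- a finite set of `D`-module generators of `D̄`
  obtain ⟨G, hG⟩ := Module.finite_def.mp ‹Module.Finite D (integralClosure D K)›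
  let G' : Set K := ((fun g : integralClosure D K => (g : K)) '' (G : Set (integralClosure D K)))
  have hG'fin : G'.Finite := (G.finite_toSet).image _
  have hG'int : ∀ x ∈ G', IsIntegral S x := by
    rintro _ ⟨g, -, rfl⟩
    exact (g.2 : IsIntegral D (g : K)).tower_top
  -- `S[D̄] = S[G']`
  have hadj : Algebra.adjoin S ((integralClosure D K : Subalgebra D K) : Set K) =
      Algebra.adjoin S G' := by
    apply le_antisymm
    · refine Algebra.adjoin_le fun n hn => ?_
      -- `n` is a `D`-linear combination of `G`
      have hn' : (⟨n, hn⟩ : integralClosure D K) ∈ Submodule.span D (G : Set (integralClosure D K)) := by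
        rw [hG]; exact Submodule.mem_top
      have key : ∀ m ∈ Submodule.span D (G : Set (integralClosure D K)),
          (m : K) ∈ Algebra.adjoin S G' := by
        intro m hm
        refine Submodule.span_induction
          (p := fun (m : integralClosure D K) _ => (m : K) ∈ Algebra.adjoin S G')
          ?_ ?_ ?_ ?_ hm
        · intro g hg
          exact Algebra.subset_adjoin ⟨g, hg, rfl⟩
        · exact Subalgebra.zero_mem _
        · intro a b _ _ ha hb
          exact Subalgebra.add_mem _ ha hb
        · intro d a _ ha
          change (d • (a : K)) ∈ Algebra.adjoin S G'
          rw [Algebra.smul_def, IsScalarTower.algebraMap_apply D S K]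
          exact Subalgebra.mul_mem _ (Subalgebra.algebraMap_mem _ _) ha
      exact key _ hn'
    · exact Algebra.adjoin_mono (by rintro _ ⟨g, -, rfl⟩; exact g.2)
  rw [integralClosure_eq_adjoin_of_isDedekindDomain S, hadj]
  exact Module.Finite.iff_fg.mpr (fg_adjoin_of_finite hG'fin hG'int)

end Intermediate

end Literature.AlgebraicGeometry.Resolution
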